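import Summits.Ventures.WeilGRH.TwistedWindowForm
import Summits.RiemannHypothesis.RiemannHypothesis.Theorems.WeilFormatCWindowSectors
import HarnessLib

/-!
# GRH arm (rh-explicit, venture WeilGRH): sector (parity) decoupling of the twisted window form for
  REAL characters — per-parity certificates suffice

Cell `rh-explicit`, WEIL TRACK — GRH ARM (typing seat weil-grh-1; TYPING-SPEC-grh2 T4).  Sequel of
`TwistedWindowForm.lean`; the `χ`-twisted analogue of `WeilFormatCWindowParity/Sectors.lean` (weil-3).

For a REAL twist `ω ∈ ℝ` the twisted increment is an affine combination of the plain increment and the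
`L²` norm:

  `D^ω_t(u) = ω D_t(u) + (1 − ω)² ‖u‖₂²`        (`weilTwistIncrement_ofReal`)

(pointwise `|a − ωb|² = ω|a − b|² + (1 − ω)(|a|² − ω|b|²)` and translation invariance).  Hence for a real
character (`conj χ(n) = χ(n)`, i.e. `χ(n) ∈ {0, ±1}`) the twisted window form
`𝓔^χ_a(u) − M^χ_a‖u‖₂²` is PARITY-ADDITIVE, `F(e + o) = F(e) + F(o)` for an even and an odd window function
(`twistedWindowForm_add_of_even_odd`; every ingredient — `D_t`, `‖·‖₂²` — is parity-diagonal by the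
format-C lemmas), and per-sector certificates suffice:

* `twistedWindowForm_sum_chi_nonneg_of_sectors`: non-negativity on EVEN (`c_{-n} = c_n`) and on ODD
  (`c_{-n} = −c_n`) trigonometric windows ⟹ on all trigonometric windows;
* `weilPositivityOnChar_of_twisted_sector_nonneg` (**the sector dictionary**): for `q ≠ 1`, `a > 0`,
  `χ` real, per-parity non-negativity of the twisted window form on the trigonometric windows ⟹
  `WeilPositivityOnChar χ a` — the shape of the cell's K(t)-closure certificates for `3.2`, `4.3`, `5.4`
  (EXTREMALS/GRH/Kt-closure-log3half-CERT: one certificate per (χ, sector)).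

For complex `χ(n)` the sectors do NOT decouple (the cross term picks up `χ̄(n)² ≠ 1`); nothing is
claimed there.  No new definitions; no named facts; RH/GRH-free.
-/

set_option autoImplicit false

noncomputable section

open Complex Filter Set MeasureTheory
open scoped Real Topology ComplexConjugate ArithmeticFunction.vonMangoldt

namespace Summit.Ventures.WeilGRH

open Literature.NumberTheory.LFunctions
open Literature.NumberTheory.LFunctions.Yoshida1992 (modes chi)
open Summit.RiemannHypothesis.RiemannHypothesis.Theorems.WeilFormatC

variable {q : ℕ} {a S Se So Le Lo : ℝ} {u e o : ℝ → ℂ}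

/-! ## Real twists: `D^ω = ω D + (1 − ω)² ‖·‖²` -/

/-- The `L²` norm of a bounded measurable function vanishing off `[-a, a]` is finite. -/
theorem integrable_norm_sq_window (hm : Measurable u) (hz : ∀ x, x ∉ Icc (-a) a → u x = 0)
    (hb : ∀ x, ‖u x‖ ≤ S) : Integrable fun x ↦ ‖u x‖ ^ 2 := by
  have hp := (integrable_window_mul_window hm hz hb hm hb).re
  refine hp.congr (Eventually.of_forall fun x ↦ ?_)
  simp only [Complex.mul_conj, Complex.sq_norm]
  norm_cast

/-- **Real twists are affine in the plain increment**: for `ω ∈ ℝ` and a bounded measurable `u`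
vanishing off `[-a, a]`, `D^ω_t(u) = ω D_t(u) + (1 − ω)² ‖u‖₂²`. -/
theorem weilTwistIncrement_ofReal (hm : Measurable u) (hz : ∀ x, x ∉ Icc (-a) a → u x = 0)
    (hb : ∀ x, ‖u x‖ ≤ S) (ω t : ℝ) :
    weilTwistIncrement (ω : ℂ) u t = ω * weilIncrement u t + (1 - ω) ^ 2 * ∫ x, ‖u x‖ ^ 2 := by
  have hN : Integrable fun x ↦ ‖u x‖ ^ 2 := integrable_norm_sq_window hm hz hb
  have hNt : Integrable fun x ↦ ‖u (x + t)‖ ^ 2 := hN.comp_add_right t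
  have hD := integrable_norm_sub_sq_window hm hz hb t
  have hpt : ∀ x, ‖u (x + t) - (ω : ℂ) * u x‖ ^ 2 =
      ω * ‖u (x + t) - u x‖ ^ 2 + ((1 - ω) * ‖u (x + t)‖ ^ 2 - ω * (1 - ω) * ‖u x‖ ^ 2) := by
    intro x
    rw [norm_sub_sq_complex, norm_sub_sq_complex, norm_mul, Complex.norm_real, Real.norm_eq_abs,
      mul_pow, sq_abs, map_mul, Complex.conj_ofReal,
      show u (x + t) * ((ω : ℂ) * conj (u x)) = (ω : ℂ) * (u (x + t) * conj (u x)) by ring,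
      Complex.re_ofReal_mul]
    ring
  have h1 : Integrable fun x ↦ ω * ‖u (x + t) - u x‖ ^ 2 := hD.const_mul ω
  have h3 : Integrable fun x ↦ (1 - ω) * ‖u (x + t)‖ ^ 2 := hNt.const_mul _
  have h4 : Integrable fun x ↦ ω * (1 - ω) * ‖u x‖ ^ 2 := hN.const_mul _
  have h2 : Integrable fun x ↦ (1 - ω) * ‖u (x + t)‖ ^ 2 - ω * (1 - ω) * ‖u x‖ ^ 2 := h3.sub h4
  unfold weilTwistIncrement weilIncrement
  simp_rw [hpt]
  rw [integral_add h1 h2, integral_sub h3 h4, integral_const_mul, integral_const_mul, integral_const_mul,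
    integral_add_right_eq_self (fun x ↦ ‖u x‖ ^ 2) t]
  ring

/-- **Real-twisted increments are parity-diagonal**: for `ω ∈ ℝ` and an even `e` and an odd `o`
(bounded measurable, vanishing off `[-a, a]`), `D^ω_t(e + o) = D^ω_t(e) + D^ω_t(o)`. -/
theorem weilTwistIncrement_add_of_even_odd_ofReal (hme : Measurable e)
    (hze : ∀ x, x ∉ Icc (-a) a → e x = 0) (hbe : ∀ x, ‖e x‖ ≤ Se) (hmo : Measurable o)
    (hzo : ∀ x, x ∉ Icc (-a) a → o x = 0) (hbo : ∀ x, ‖o x‖ ≤ So) (he : ∀ x, e (-x) = e x)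
    (ho : ∀ x, o (-x) = -o x) (ω t : ℝ) :
    weilTwistIncrement (ω : ℂ) (e + o) t =
      weilTwistIncrement (ω : ℂ) e t + weilTwistIncrement (ω : ℂ) o t := by
  have hm : Measurable (e + o) := hme.add hmo
  have hz : ∀ x, x ∉ Icc (-a) a → (e + o) x = 0 := fun x hx ↦ by
    simp [hze x hx, hzo x hx]
  have hb : ∀ x, ‖(e + o) x‖ ≤ Se + So := fun x ↦ (norm_add_le _ _).trans (add_le_add (hbe x) (hbo x))
  rw [weilTwistIncrement_ofReal hm hz hb, weilTwistIncrement_ofReal hme hze hbe,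
    weilTwistIncrement_ofReal hmo hzo hbo, weilIncrement_add_of_even_odd hme hze hbe hmo hzo hbo he ho,
    integral_norm_sq_add_of_even_odd hme hze hbe hmo hzo hbo he ho]
  ring

/-! ## Parity-additivity of the twisted window form for real characters -/

/-- The parity-`κ` archimedean energy of a window function is finite (`a ≥ 0`): domination by the
parity-`0` energy `integrableOn_weilArchDensity_mul_weilIncrement_window`. -/
theorem integrableOn_weilArchDensityPar_mul_weilIncrement_window (ha : 0 ≤ a) (hm : Measurable u)
    (hz : ∀ x, x ∉ Icc (-a) a → u x = 0) (hb : ∀ x, ‖u x‖ ≤ S)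
    (hl : ∀ x y, x ∈ Icc (-a) a → y ∈ Icc (-a) a → ‖u y - u x‖ ≤ Le * |y - x|) (κ : ℕ) :
    IntegrableOn (fun t ↦ weilArchDensityPar κ t * weilIncrement u t) (Ioi 0) := by
  refine (integrableOn_weilArchDensity_mul_weilIncrement_window ha hm hz hb hl).mono'
    (((measurable_weilArchDensityPar κ).mul (measurable_weilIncrement hm)).aestronglyMeasurable) ?_
  refine (ae_restrict_iff' measurableSet_Ioi).2 (Eventually.of_forall fun t ht ↦ ?_)
  obtain ⟨h0, hle⟩ := weilArchDensityPar_nonneg_le κ ht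
  have hD : 0 ≤ weilIncrement u t := weilIncrement_nonneg _ _
  rw [Real.norm_of_nonneg (mul_nonneg h0 hD)]
  exact mul_le_mul_of_nonneg_right hle hD

/-- A real character takes real values: `conj χ(n) = χ(n)` gives `conj χ(n) = ((χ n).re : ℂ)`. -/
private theorem conj_eq_ofReal_re {z : ℂ} (h : conj z = z) : conj z = ((z.re : ℝ) : ℂ) := by
  rw [h]; exact (Complex.conj_eq_iff_re.1 h).symm

/-- **The twisted window form of a REAL character is parity-additive**: for `χ` with `conj χ(n) = χ(n)`
for all `n`, an even window function `e` and an odd one `o` on `[-a, a]` (`a ≥ 0`),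
`F(e + o) = F(e) + F(o)` with `F(u) = 𝓔^χ_b(u) − M^χ_b ‖u‖₂²`. -/
theorem twistedWindowForm_add_of_even_odd (χ : DirichletCharacter ℂ q)
    (hχ : ∀ n : ℕ, conj (χ (n : ZMod q)) = χ (n : ZMod q)) (ha : 0 ≤ a) (hme : Measurable e)
    (hze : ∀ x, x ∉ Icc (-a) a → e x = 0) (hbe : ∀ x, ‖e x‖ ≤ Se)
    (hle : ∀ x y, x ∈ Icc (-a) a → y ∈ Icc (-a) a → ‖e y - e x‖ ≤ Le * |y - x|)
    (hmo : Measurable o) (hzo : ∀ x, x ∉ Icc (-a) a → o x = 0) (hbo : ∀ x, ‖o x‖ ≤ So)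
    (hlo : ∀ x y, x ∈ Icc (-a) a → y ∈ Icc (-a) a → ‖o y - o x‖ ≤ Lo * |y - x|)
    (he : ∀ x, e (-x) = e x) (ho : ∀ x, o (-x) = -o x) (b : ℝ) :
    weilDirichletEnergyChar χ b (e + o) - weilMarkovConstantChar χ b * ∫ x, ‖(e + o) x‖ ^ 2 =
      (weilDirichletEnergyChar χ b e - weilMarkovConstantChar χ b * ∫ x, ‖e x‖ ^ 2) +
        (weilDirichletEnergyChar χ b o - weilMarkovConstantChar χ b * ∫ x, ‖o x‖ ^ 2) := by
  unfold weilDirichletEnergyChar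
  have hsum : ∀ w : ℝ → ℂ, (∑ n ∈ weilPrimeIndex b, (Λ n : ℝ) / Real.sqrt n *
      weilTwistIncrement (conj (χ (n : ZMod q))) w (Real.log n)) =
      ∑ n ∈ weilPrimeIndex b, (Λ n : ℝ) / Real.sqrt n *
        weilTwistIncrement (((χ (n : ZMod q)).re : ℝ) : ℂ) w (Real.log n) := fun w ↦
    Finset.sum_congr rfl fun n _ ↦ by rw [conj_eq_ofReal_re (hχ n)]
  rw [hsum, hsum, hsum]
  simp_rw [weilTwistIncrement_add_of_even_odd_ofReal hme hze hbe hmo hzo hbo he ho,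
    weilIncrement_add_of_even_odd hme hze hbe hmo hzo hbo he ho]
  rw [integral_norm_sq_add_of_even_odd hme hze hbe hmo hzo hbo he ho]
  have hIe := integrableOn_weilArchDensityPar_mul_weilIncrement_window ha hme hze hbe hle (charParity χ)
  have hIo := integrableOn_weilArchDensityPar_mul_weilIncrement_window ha hmo hzo hbo hlo (charParity χ)
  have harch : ∫ t in Ioi (0 : ℝ), weilArchDensityPar (charParity χ) t * (weilIncrement e t + weilIncrement o t) =
      (∫ t in Ioi (0 : ℝ), weilArchDensityPar (charParity χ) t * weilIncrement e t) +
        ∫ t in Ioi (0 : ℝ), weilArchDensityPar (charParity χ) t * weilIncrement o t := by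
    rw [← integral_add hIe hIo]
    exact integral_congr_ae (Eventually.of_forall fun t ↦ mul_add _ _ _)
  rw [harch, Finset.sum_congr rfl fun n _ ↦ mul_add _ _ _, Finset.sum_add_distrib]
  ring

/-! ## The sector dictionary for real characters -/

/-- **Sector certificates suffice** (real `χ`, `a > 0`): if the twisted window form is non-negative on
every EVEN trigonometric window and on every ODD one, it is non-negative on every trigonometric window
(split `c = c^{ev} + c^{od}`). -/
theorem twistedWindowForm_sum_chi_nonneg_of_sectors (χ : DirichletCharacter ℂ q)
    (hχ : ∀ n : ℕ, conj (χ (n : ZMod q)) = χ (n : ZMod q)) (ha : 0 < a)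
    (hev : ∀ (N : ℕ) (c : ℤ → ℂ), (∀ n, c (-n) = c n) →
      0 ≤ weilDirichletEnergyChar χ a (∑ n ∈ modes N, c n • chi a n) -
        weilMarkovConstantChar χ a * ∫ x : ℝ, ‖(∑ n ∈ modes N, c n • chi a n) x‖ ^ 2)
    (hod : ∀ (N : ℕ) (c : ℤ → ℂ), (∀ n, c (-n) = -c n) →
      0 ≤ weilDirichletEnergyChar χ a (∑ n ∈ modes N, c n • chi a n) -
        weilMarkovConstantChar χ a * ∫ x : ℝ, ‖(∑ n ∈ modes N, c n • chi a n) x‖ ^ 2)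
    (N : ℕ) (c : ℤ → ℂ) :
    0 ≤ weilDirichletEnergyChar χ a (∑ n ∈ modes N, c n • chi a n) -
      weilMarkovConstantChar χ a * ∫ x : ℝ, ‖(∑ n ∈ modes N, c n • chi a n) x‖ ^ 2 := by
  set ce : ℤ → ℂ := fun n ↦ (c n + c (-n)) / 2 with hce
  set co : ℤ → ℂ := fun n ↦ (c n - c (-n)) / 2 with hco
  have hce' : ∀ n, ce (-n) = ce n := fun n ↦ by simp only [hce, neg_neg]; ring
  have hco' : ∀ n, co (-n) = -co n := fun n ↦ by simp only [hco, neg_neg]; ring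
  have hsplit : (∑ n ∈ modes N, c n • chi a n) =
      (∑ n ∈ modes N, ce n • chi a n) + ∑ n ∈ modes N, co n • chi a n := by
    rw [← Finset.sum_add_distrib]
    refine Finset.sum_congr rfl fun n _ ↦ ?_
    rw [← add_smul]
    congr 1
    simp only [hce, hco]
    ring
  rw [hsplit, twistedWindowForm_add_of_even_odd χ hχ ha.le (measurable_sum_smul_chi _ _)
    (fun x hx ↦ sum_smul_chi_eq_zero _ _ hx) (fun x ↦ norm_sum_smul_chi_le _ _ x)
    (fun x y hx hy ↦ norm_sum_smul_chi_sub_le ha _ _ hx hy) (measurable_sum_smul_chi _ _)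
    (fun x hx ↦ sum_smul_chi_eq_zero _ _ hx) (fun x ↦ norm_sum_smul_chi_le _ _ x)
    (fun x y hx hy ↦ norm_sum_smul_chi_sub_le ha _ _ hx hy) (sum_smul_chi_even hce')
    (sum_smul_chi_odd hco')]
  exact add_nonneg (hev N ce hce') (hod N co hco')

/-- **THE SECTOR DICTIONARY for real characters** (`q ≠ 1`, `a > 0`, `conj χ = χ`): per-parity
non-negativity of the twisted window form on the trigonometric windows — on every EVEN coefficient
vector and on every ODD one, for every `N` — implies `WeilPositivityOnChar χ a`.  This is the shape
of the cell's K(t)-closure / format-C certificates for real `χ` (one certificate per (χ, sector)). -/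
theorem weilPositivityOnChar_of_twisted_sector_nonneg (hq : q ≠ 1) (χ : DirichletCharacter ℂ q)
    (hχ : ∀ n : ℕ, conj (χ (n : ZMod q)) = χ (n : ZMod q)) (ha : 0 < a)
    (hev : ∀ (N : ℕ) (c : ℤ → ℂ), (∀ n, c (-n) = c n) →
      0 ≤ weilDirichletEnergyChar χ a (∑ n ∈ modes N, c n • chi a n) -
        weilMarkovConstantChar χ a * ∫ x : ℝ, ‖(∑ n ∈ modes N, c n • chi a n) x‖ ^ 2)
    (hod : ∀ (N : ℕ) (c : ℤ → ℂ), (∀ n, c (-n) = -c n) →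
      0 ≤ weilDirichletEnergyChar χ a (∑ n ∈ modes N, c n • chi a n) -
        weilMarkovConstantChar χ a * ∫ x : ℝ, ‖(∑ n ∈ modes N, c n • chi a n) x‖ ^ 2) :
    WeilPositivityOnChar χ a :=
  weilPositivityOnChar_of_twistedWindowForm_sum_chi_nonneg hq χ ha
    (twistedWindowForm_sum_chi_nonneg_of_sectors χ hχ ha hev hod)

end Summit.Ventures.WeilGRH

end
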